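import Mathlib.Analysis.SpecialFunctions.SmoothTransition
import Mathlib.Analysis.InnerProductSpace.Calculus
import Mathlib.Analysis.Complex.Basic
import Mathlib.Analysis.SpecialFunctions.Sqrt
import Mathlib.Analysis.Real.Pi.Bounds
import Mathlib.Analysis.SpecialFunctions.Complex.Arg
import Literature.Topology.FourManifolds.TorusCoordinates
import HarnessLib

/-!
# An explicit `(1, ±1)` Dehn surgery on the unknot in `ℝ³`: the singular self-map of `ℝ³ ∖ U`

Infrastructure for the proof programme of the named fact
`Literature.Topology.FourManifolds.Iwase1988_gluckTwist_isTorusLinkSurgery` (`TorusSurgery.lean`;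
Z. Iwase, *Dehn-surgery along a torus T²-knot*, Pacific J. Math. 133 (1988), Prop. 3.5). In
Iwase's proof (loc. cit. p. 297) the torus `K'` is the 2-knot `K` with a 1-handle `H = D³ × D¹`
attached, `K' ∩ H = U × D¹` for an unknot `U ⊂ D³`, and on every slice `D³ × {∗}` of the handle
the torus surgery restricts to **the Dehn surgery of type `(1, 1)` or `(1, -1)` along `U` in
`D³`, which is `D³` again, by a diffeomorphism fixed near `∂D³`** (the map `F_*`, loc. cit.).
This file provides that three-dimensional ingredient in the explicit, relational form used by the
tree's surgery predicates (`IsTorusLinkSurgery`, `Knot.IsSurgery`), on `ℝ³ = ℂ × ℝ ∋ (ζ, c)` with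
the round unknot `U = {‖ζ‖ = 1, c = 0}`, for a **radial profile** `G : ℝ → ℝ` and a **cut-off**
`μ : ℂ × ℝ → [0, 1]` (both parameters: in dimension four they vary along the handle):

* `Literature.Topology.FourManifolds.UnknotSurgery.theta G μ`, `thetaInv G μ` — mutually inverse
  `C^∞` self-maps of `ℝ³ ∖ U`, jointly smooth in smooth families of data, equal to the identity
  where the cut-off is complete (`μ = 1`), of the form `(ζ, c) ↦ (P(ζ, c)^{±1} · ζ, c)` with a
  unit complex *phase* `P` (`phase`): the inverse unit vector of the convex combination
  `(1 - μ) · A/‖A‖ + μ · 1` (`phaseRaw`) for `A_G(ζ, c) = 1 - G(‖ζ‖²) e^{-ic}` (`afun`). For an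
  admissible cut-off (`IsAdmissibleCutoff`: incomplete only at heights `|c| < π`, vanishing on the
  open spanning disc `{c = 0, G > 1}`) and a profile with `G u = 1 ↔ u = 1`, the raw phase never
  vanishes off `U` (`phaseRaw_ne_zero`): inside `|c| < π`, `A` vanishes exactly on `U` and is a
  non-positive real exactly on the spanning disc, because its imaginary part `G sin c` has the sign
  of `c` (`eq_zero_and_one_le_of_afun`) — the half-plane argument that also makes all later
  convex combinations of such phases safe;
* `Literature.Topology.FourManifolds.UnknotSurgery.tube m z n = (ρ · z, -arg (1 - n))`,
  `ρ² = 1 + (1 - ‖1 - n‖)/m` — the ADAPTED tubular parametrisation of `U` (`z ∈ S¹` the core point,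
  `n ∈ ℂ` the normal coordinate) for a profile affine of slope `-m` near `u = 1`
  (`gaff m u = 1 - m (u - 1)`), in which `A = n` exactly (`afun_tube`), and the **exact tube
  relations** `theta G μ (tube m (z · n/‖n‖) n) = tube m z n`,
  `thetaInv G μ (tube m (z · (n/‖n‖)⁻¹) n) = tube m z n` for tube-adapted data (`IsTubeAdapted`;
  `theta_tube`, `thetaInv_tube`): precomposed with the shear "rotate the core point by the unit
  normal vector" — the `(1, ∓1)` regluing of the boundary torus, meridian `↦` meridian `∓`
  longitude — `Θ` becomes the tube map itself, in particular smooth ACROSS the core. This is the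
  statement that `ℝ³` with the tube around `U` is the `(1, ±1)` Dehn surgery on `U` in the
  relational sense, by a map which is the identity off a neighbourhood (Rolfsen, *Knots and Links*
  (1976), §9.H: `±1` surgery on an unknot returns `S³`; Gompf–Stipsicz, *4-Manifolds and Kirby
  Calculus* (1999), §5.3);
* the standard data: the affine profile `gaff m` and the radial cut-off
  `cutoff = smoothTransition (‖ζ‖² + c² - 4)` are admissible and tube adapted for `m > 0`
  (`isAdmissibleCutoff_cutoff`, `isTubeAdapted_gaff_cutoff`); for them `Θ` is the identity
  outside the ball `‖ζ‖² + c² < 5`.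

Everything is explicit calculus in `ℂ × ℝ` (`ContDiff ℝ ∞`); no manifold structure is used here.
The four-dimensional use (the handle slices of Iwase's construction, transported by an explicit
handle chart, with `m` varying along the handle and `e^{-ic} = w̄/‖w‖` the conjugate unit normal of
the 2-knot) is left to the sibling files of the programme.

## References

* Z. Iwase, *Dehn-surgery along a torus T²-knot*, Pacific J. Math. 133 (1988) 289–299, proof of
  Prop. 3.5, p. 297. [Iwase1988]
* D. Rolfsen, *Knots and Links*, Publish or Perish (1976), Ch. 9 §H. [Rolfsen1976]
* R. Gompf, A. Stipsicz, *4-Manifolds and Kirby Calculus*, GSM 20 (1999), §5.3.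

## Design notes

* The phase is cut off by normalising a convex combination of the unit vector of `A` and `1`, not
  by cutting off an argument function (`arg A` jumps by `2π` across the open spanning disc; its
  unit vector does not). The far zeros of `A` (heights `|c| ≥ π`) lie outside the ball
  `‖ζ‖² + c² < 5 < π²`, where the cut-off is complete.
* Junk values: on `U` itself `phase G μ = 0⁻¹ = 0` and `theta = thetaInv = (0, c)`; never used
  (all statements are off `U`). `nrm 0 = 0`.
* Real smoothness of `arg` on the slit plane is the tree's `contDiffAt_arg` (`TorusCoordinates.lean`).
* No declaration in this file uses `sorry`.
-/

open scoped ContDiff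
open Complex Set Function

noncomputable section

namespace Literature.Topology.FourManifolds

namespace UnknotSurgery

/-! ### The unknot and the radius -/

/-- The round **unknot** `U = {‖ζ‖ = 1, c = 0}` in `ℝ³ = ℂ × ℝ`. [folklore] -/
def unknot : Set (ℂ × ℝ) := {p | ‖p.1‖ = 1 ∧ p.2 = 0}

/-- The squared distance from the origin, `‖ζ‖² + c²` (a smooth radius-squared used for the
cut-off). [folklore] -/
def sqRad (p : ℂ × ℝ) : ℝ := ‖p.1‖ ^ 2 + p.2 ^ 2

/-- `sqRad` is smooth. [folklore] -/
theorem contDiff_sqRad : ContDiff ℝ ∞ sqRad :=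
  ((contDiff_norm_sq ℝ).comp contDiff_fst).add (contDiff_snd.pow 2)

/-- On the ball `‖ζ‖² + c² < 5` the height is less than `π` in absolute value (`5 < π²`).
[folklore] -/
theorem abs_lt_pi_of_sqRad_lt {p : ℂ × ℝ} (hp : sqRad p < 5) : |p.2| < Real.pi := by
  have hπ : (3 : ℝ) < Real.pi := Real.pi_gt_three
  have h2 : p.2 ^ 2 < 5 := by
    have := sq_nonneg ‖p.1‖; unfold sqRad at hp; nlinarith
  rw [abs_lt]
  constructor <;> nlinarith

/-! ### Normalisation of complex numbers -/

/-- Normalisation `z ↦ z / ‖z‖` of a complex number (junk value `0` at `0`). [folklore] -/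
def nrm (z : ℂ) : ℂ := Complex.ofReal ‖z‖⁻¹ * z

/-- A normalised non-zero number is a unit. [folklore] -/
theorem norm_nrm {z : ℂ} (hz : z ≠ 0) : ‖nrm z‖ = 1 := by
  rw [nrm, norm_mul, Complex.norm_real, norm_inv, norm_norm, inv_mul_cancel₀ (norm_ne_zero_iff.2 hz)]

/-- A normalised non-zero number is non-zero. [folklore] -/
theorem nrm_ne_zero {z : ℂ} (hz : z ≠ 0) : nrm z ≠ 0 :=
  norm_ne_zero_iff.1 (by rw [norm_nrm hz]; exact one_ne_zero)

/-- Normalisation is smooth off the origin. [folklore] -/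
theorem contDiffAt_nrm {z : ℂ} (hz : z ≠ 0) : ContDiffAt ℝ ∞ nrm z := by
  unfold nrm
  exact (Complex.ofRealCLM.contDiff.contDiffAt.comp z ((contDiffAt_norm ℝ hz).inv
    (norm_ne_zero_iff.2 hz))).mul contDiffAt_id

/-- Normalisation is multiplicative. [folklore] -/
theorem nrm_mul (a b : ℂ) : nrm (a * b) = nrm a * nrm b := by
  simp only [nrm, norm_mul, mul_inv, Complex.ofReal_mul]
  ring

/-- Normalisation fixes units. [folklore] -/
theorem nrm_of_norm_eq_one {u : ℂ} (hu : ‖u‖ = 1) : nrm u = u := by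
  simp [nrm, hu]

/-- Normalisation of a positive real is `1`. [folklore] -/
theorem nrm_ofReal_of_pos {r : ℝ} (hr : 0 < r) : nrm (r : ℂ) = 1 := by
  rw [nrm, Complex.norm_real, Real.norm_eq_abs, abs_of_pos hr, ← Complex.ofReal_mul,
    inv_mul_cancel₀ hr.ne', Complex.ofReal_one]

/-- Normalisation of a quotient. [folklore] -/
theorem nrm_div {a b : ℂ} (hb : b ≠ 0) : nrm (a / b) = nrm a / nrm b := by
  rw [eq_div_iff (nrm_ne_zero hb), ← nrm_mul, div_mul_cancel₀ _ hb]

/-- Normalisation is idempotent on non-zero numbers. [folklore] -/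
theorem nrm_nrm {z : ℂ} (hz : z ≠ 0) : nrm (nrm z) = nrm z :=
  nrm_of_norm_eq_one (norm_nrm hz)

/-- Real part of the normalisation. [folklore] -/
theorem nrm_re (z : ℂ) : (nrm z).re = ‖z‖⁻¹ * z.re := by
  simp [nrm]

/-- Imaginary part of the normalisation. [folklore] -/
theorem nrm_im (z : ℂ) : (nrm z).im = ‖z‖⁻¹ * z.im := by
  simp [nrm]

/-! ### The cut-off weight -/

/-- The cut-off weight `μ = smoothTransition (‖ζ‖² + c² - 4)`: `0` on the ball `‖ζ‖² + c² ≤ 4`,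
`1` outside the ball `‖ζ‖² + c² < 5`, smooth. [folklore] -/
def cutoff (p : ℂ × ℝ) : ℝ := Real.smoothTransition (sqRad p - 4)

/-- The cut-off weight is smooth. [folklore] -/
theorem contDiff_cutoff : ContDiff ℝ ∞ cutoff :=
  Real.smoothTransition.contDiff.comp
    ((((contDiff_norm_sq ℝ).comp contDiff_fst).add (contDiff_snd.pow 2)).sub contDiff_const)

/-- The cut-off weight vanishes on the ball `‖ζ‖² + c² ≤ 4`. [folklore] -/
theorem cutoff_eq_zero {p : ℂ × ℝ} (hp : sqRad p ≤ 4) : cutoff p = 0 :=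
  Real.smoothTransition.zero_of_nonpos (by linarith)

/-- The cut-off weight is `1` outside the ball `‖ζ‖² + c² < 5`. [folklore] -/
theorem cutoff_eq_one {p : ℂ × ℝ} (hp : 5 ≤ sqRad p) : cutoff p = 1 :=
  Real.smoothTransition.one_of_one_le (by linarith)

/-- The cut-off weight only depends on `(‖ζ‖, c)`. [folklore] -/
theorem cutoff_eq_of_norm_eq {p p' : ℂ × ℝ} (h1 : ‖p.1‖ = ‖p'.1‖) (h2 : p.2 = p'.2) :
    cutoff p = cutoff p' := by
  simp only [cutoff, sqRad, h1, h2]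


/-! ### The function `A = 1 - G(‖ζ‖²) e^{-ic}` for a radial profile `G` -/

/-- The affine radial profile `G_m(u) = 1 - m (u - 1)` of slope `-m` with `G_m(1) = 1`; every
admissible profile agrees with it near `u = 1`. [folklore] -/
def gaff (m u : ℝ) : ℝ := 1 - m * (u - 1)

/-- **The function `A_G(ζ, c) = 1 - G(‖ζ‖²) e^{-ic}`** `= (1 - G cos c) + i G sin c` for a radial
profile `G : ℝ → ℝ`, whose unit vector is the surgery phase near the unknot: for a profile with
`G u = 1 ↔ u = 1` it vanishes, at heights `|c| < π`, exactly on the unknot; its imaginary part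
`G sin c` has the sign of `c` where `G > 0`. [folklore] -/
def afun (G : ℝ → ℝ) (p : ℂ × ℝ) : ℂ :=
  Complex.ofReal (1 - G (‖p.1‖ ^ 2) * Real.cos p.2) +
    Complex.ofReal (G (‖p.1‖ ^ 2) * Real.sin p.2) * I

variable {G : ℝ → ℝ}

/-- Real part of `A`. [folklore] -/
@[simp] theorem afun_re (G : ℝ → ℝ) (p : ℂ × ℝ) :
    (afun G p).re = 1 - G (‖p.1‖ ^ 2) * Real.cos p.2 := by
  simp only [afun, Complex.add_re, Complex.ofReal_re, Complex.mul_re, Complex.I_re, Complex.I_im,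
    Complex.ofReal_im]
  ring

/-- Imaginary part of `A`. [folklore] -/
@[simp] theorem afun_im (G : ℝ → ℝ) (p : ℂ × ℝ) :
    (afun G p).im = G (‖p.1‖ ^ 2) * Real.sin p.2 := by
  simp only [afun, Complex.add_im, Complex.ofReal_im, Complex.mul_im, Complex.I_re, Complex.I_im,
    Complex.ofReal_re]
  ring

/-- `A` only depends on `(‖ζ‖, c)`. [folklore] -/
theorem afun_eq_of_norm_eq (G : ℝ → ℝ) {p p' : ℂ × ℝ} (h1 : ‖p.1‖ = ‖p'.1‖) (h2 : p.2 = p'.2) :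
    afun G p = afun G p' := by
  simp only [afun, h1, h2]

/-- **`A` is jointly smooth in the profile parameter and `(ζ, c)`** for a smooth family of
profiles `G : X → ℝ → ℝ` over a parameter space `X`. [folklore] -/
theorem contDiff_afun_family {X : Type*} [NormedAddCommGroup X] [NormedSpace ℝ X]
    {G : X → ℝ → ℝ} (hG : ContDiff ℝ ∞ fun q : X × ℝ => G q.1 q.2) :
    ContDiff ℝ ∞ fun q : X × (ℂ × ℝ) => afun (G q.1) q.2 := by
  have hGq : ContDiff ℝ ∞ fun q : X × (ℂ × ℝ) => G q.1 (‖q.2.1‖ ^ 2) :=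
    hG.comp (contDiff_fst.prodMk ((contDiff_norm_sq ℝ).comp (contDiff_fst.comp contDiff_snd)))
  have hc : ContDiff ℝ ∞ fun q : X × (ℂ × ℝ) => q.2.2 := contDiff_snd.comp contDiff_snd
  unfold afun
  exact (Complex.ofRealCLM.contDiff.comp (contDiff_const.sub (hGq.mul (Real.contDiff_cos.comp hc)))).add
    ((Complex.ofRealCLM.contDiff.comp (hGq.mul (Real.contDiff_sin.comp hc))).mul contDiff_const)

/-- `A` is smooth for a fixed smooth profile. [folklore] -/
theorem contDiff_afun (hG : ContDiff ℝ ∞ G) : ContDiff ℝ ∞ (afun G) := by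
  have hGq : ContDiff ℝ ∞ fun q : ℂ × ℝ => G (‖q.1‖ ^ 2) :=
    hG.comp ((contDiff_norm_sq ℝ).comp contDiff_fst)
  unfold afun
  exact (Complex.ofRealCLM.contDiff.comp (contDiff_const.sub (hGq.mul
    (Real.contDiff_cos.comp contDiff_snd)))).add ((Complex.ofRealCLM.contDiff.comp (hGq.mul
    (Real.contDiff_sin.comp contDiff_snd))).mul contDiff_const)

/-- **Where `A` is a non-positive real**: inside `|c| < π`, `Im A = 0` and `Re A ≤ 0` force `c = 0`
and `1 ≤ G(‖ζ‖²)` — for an admissible profile, the spanning disc of the unknot. [folklore] -/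
theorem eq_zero_and_one_le_of_afun {p : ℂ × ℝ} (hp : |p.2| < Real.pi)
    (him : (afun G p).im = 0) (hre : (afun G p).re ≤ 0) : p.2 = 0 ∧ 1 ≤ G (‖p.1‖ ^ 2) := by
  rw [afun_im] at him
  rw [afun_re] at hre
  have hG : G (‖p.1‖ ^ 2) ≠ 0 := fun h => by rw [h] at hre; norm_num at hre
  have hsin : Real.sin p.2 = 0 := (mul_eq_zero.1 him).resolve_left hG
  have hc : p.2 = 0 := by
    rw [abs_lt] at hp
    exact (Real.sin_eq_zero_iff_of_lt_of_lt hp.1 hp.2).1 hsin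
  refine ⟨hc, ?_⟩
  rw [hc, Real.cos_zero, mul_one] at hre
  linarith

/-- `A` vanishes on the unknot for a profile with `G 1 = 1`. [folklore] -/
theorem afun_eq_zero_of_mem (hG1 : G 1 = 1) {p : ℂ × ℝ} (hp : p ∈ unknot) : afun G p = 0 := by
  obtain ⟨h1, h2⟩ := hp
  apply Complex.ext <;> simp [h1, h2, hG1]

/-- **Inside `|c| < π`, `A` vanishes only on the unknot** (profile with `G u = 1 → u = 1`).
[folklore] -/
theorem mem_unknot_of_afun_eq_zero (hG1 : ∀ u, G u = 1 → u = 1) {p : ℂ × ℝ}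
    (hp : |p.2| < Real.pi) (h0 : afun G p = 0) : p ∈ unknot := by
  obtain ⟨hc, hle⟩ := eq_zero_and_one_le_of_afun hp (by rw [h0]; rfl) (by rw [h0]; rfl)
  have hre := congrArg Complex.re h0
  rw [afun_re, hc, Real.cos_zero, mul_one, Complex.zero_re] at hre
  have hu : ‖p.1‖ ^ 2 = 1 := hG1 _ (by linarith)
  exact ⟨by nlinarith [norm_nonneg p.1], hc⟩

/-! ### The cut-off surgery phase -/

/-- The raw phase: the convex combination `(1 - μ) · A/‖A‖ + μ · 1` of the unit vector of `A` and
of `1`, for a cut-off function `μ : ℂ × ℝ → [0, 1]`. [folklore] -/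
def phaseRaw (G : ℝ → ℝ) (μ : ℂ × ℝ → ℝ) (p : ℂ × ℝ) : ℂ :=
  Complex.ofReal (1 - μ p) * nrm (afun G p) + Complex.ofReal (μ p)

/-- **Admissible cut-offs**: `μ` takes values in `[0, 1]`, is incomplete (`< 1`) only at heights
`|c| < π`, and vanishes on the open spanning disc `{c = 0, G(‖ζ‖²) > 1}`. [folklore] -/
structure IsAdmissibleCutoff (G : ℝ → ℝ) (μ : ℂ × ℝ → ℝ) : Prop where
  nonneg : ∀ p, 0 ≤ μ p
  le_one : ∀ p, μ p ≤ 1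
  abs_lt_pi : ∀ p, μ p < 1 → |p.2| < Real.pi
  eq_zero_of_disc : ∀ p : ℂ × ℝ, p.2 = 0 → 1 < G (‖p.1‖ ^ 2) → μ p = 0

variable {μ : ℂ × ℝ → ℝ}

/-- **The raw phase never vanishes off the unknot** (admissible cut-off, profile with
`G u = 1 → u = 1`): where the cut-off is incomplete, `A` is a non-positive real only on the
spanning disc, where the cut-off vanishes and the raw phase is the unit vector of `A ≠ 0`.
[folklore] -/
theorem phaseRaw_ne_zero (hμ : IsAdmissibleCutoff G μ) (hG1 : ∀ u, G u = 1 → u = 1)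
    {p : ℂ × ℝ} (hp : p ∉ unknot) : phaseRaw G μ p ≠ 0 := by
  intro h0
  have hμ0 := hμ.nonneg p
  have hμ1 := hμ.le_one p
  rcases hμ1.lt_or_eq with hlt | heq
  · have hcπ : |p.2| < Real.pi := hμ.abs_lt_pi p hlt
    have hA : afun G p ≠ 0 := fun hA => hp (mem_unknot_of_afun_eq_zero hG1 hcπ hA)
    have h1 : 0 < 1 - μ p := by linarith
    have hninv : 0 < ‖afun G p‖⁻¹ := inv_pos.2 (norm_pos_iff.2 hA)
    have him : (1 - μ p) * (‖afun G p‖⁻¹ * (afun G p).im) = 0 := by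
      have := congrArg Complex.im h0
      simpa [phaseRaw, Complex.re_ofReal_mul, Complex.im_ofReal_mul, nrm_im] using this
    have hre : (1 - μ p) * (‖afun G p‖⁻¹ * (afun G p).re) + μ p = 0 := by
      have := congrArg Complex.re h0
      simpa [phaseRaw, Complex.re_ofReal_mul, Complex.im_ofReal_mul, nrm_re] using this
    have him' : (afun G p).im = 0 := by
      rcases mul_eq_zero.1 him with h | h
      · linarith
      · rcases mul_eq_zero.1 h with h' | h'
        · linarith
        · exact h'
    have hre' : (afun G p).re ≤ 0 := by
      by_contra hcon
      push Not at hcon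
      nlinarith [mul_pos hninv hcon]
    obtain ⟨hc, hle⟩ := eq_zero_and_one_le_of_afun hcπ him' hre'
    rcases hle.lt_or_eq with hGlt | hGeq
    · -- open spanning disc: the cut-off vanishes and the raw phase is the unit vector of `A`
      have hμz : μ p = 0 := hμ.eq_zero_of_disc p hc hGlt
      rw [phaseRaw, hμz] at h0
      simp only [sub_zero, Complex.ofReal_one, one_mul, Complex.ofReal_zero, add_zero] at h0
      exact nrm_ne_zero hA h0
    · -- `G = 1` and `c = 0`: the point is on the unknot
      have : ‖p.1‖ ^ 2 = 1 := hG1 _ hGeq.symm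
      exact hp ⟨by nlinarith [norm_nonneg p.1], hc⟩
  · rw [phaseRaw, heq] at h0
    norm_num at h0

/-- The **surgery phase** `P(ζ, c)`: the inverse (conjugate) unit vector of the raw phase; a unit
complex number off the unknot, equal to the inverse unit vector of `A` where the cut-off vanishes
and to `1` where it is complete. [folklore] -/
def phase (G : ℝ → ℝ) (μ : ℂ × ℝ → ℝ) (p : ℂ × ℝ) : ℂ := (nrm (phaseRaw G μ p))⁻¹

/-- The phase is a unit off the unknot. [folklore] -/
theorem norm_phase (hμ : IsAdmissibleCutoff G μ) (hG1 : ∀ u, G u = 1 → u = 1) {p : ℂ × ℝ}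
    (hp : p ∉ unknot) : ‖phase G μ p‖ = 1 := by
  rw [phase, norm_inv, norm_nrm (phaseRaw_ne_zero hμ hG1 hp), inv_one]

/-- The phase is non-zero off the unknot. [folklore] -/
theorem phase_ne_zero (hμ : IsAdmissibleCutoff G μ) (hG1 : ∀ u, G u = 1 → u = 1) {p : ℂ × ℝ}
    (hp : p ∉ unknot) : phase G μ p ≠ 0 :=
  inv_ne_zero (nrm_ne_zero (phaseRaw_ne_zero hμ hG1 hp))

/-- Where the cut-off vanishes the phase is the inverse unit vector of `A`. [folklore] -/
theorem phase_eq_of_cutoff_eq_zero {p : ℂ × ℝ} (hp : μ p = 0) :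
    phase G μ p = (nrm (afun G p))⁻¹ := by
  by_cases hA : afun G p = 0
  · simp [phase, phaseRaw, hp, hA, nrm]
  · rw [phase, phaseRaw, hp]
    simp [nrm_nrm hA]

/-- Where the cut-off is complete the phase is `1`. [folklore] -/
theorem phase_eq_one_of_cutoff_eq_one {p : ℂ × ℝ} (hp : μ p = 1) : phase G μ p = 1 := by
  rw [phase, phaseRaw, hp]
  simp [nrm_of_norm_eq_one (u := 1) (by simp)]

/-- The phase only depends on `(‖ζ‖, c)` if the cut-off does. [folklore] -/
theorem phase_eq_of_norm_eq {p p' : ℂ × ℝ} (h1 : ‖p.1‖ = ‖p'.1‖) (h2 : p.2 = p'.2)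
    (hμ : μ p = μ p') : phase G μ p = phase G μ p' := by
  simp only [phase, phaseRaw, hμ, afun_eq_of_norm_eq G h1 h2]

/-- **The phase is jointly smooth in the parameters and `(ζ, c)` off the unknot**, for smooth
families of profiles `G` and cut-offs `μ` over a parameter space `X`, admissible at the parameter
`x`, with the cut-offs complete beyond a height `c₃ < π` uniformly: where `A ≠ 0` this is the
smoothness of the formula; at the far zeros of `A` (heights `|c| ≥ π`) the raw phase is `1`
nearby. [folklore] -/
theorem contDiffAt_phase_family {X : Type*} [NormedAddCommGroup X] [NormedSpace ℝ X]
    {G : X → ℝ → ℝ} {μ : X → ℂ × ℝ → ℝ} (hG : ContDiff ℝ ∞ fun q : X × ℝ => G q.1 q.2)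
    (hμs : ContDiff ℝ ∞ fun q : X × (ℂ × ℝ) => μ q.1 q.2) {c₃ : ℝ} (hc₃ : c₃ < Real.pi)
    (hfar : ∀ x p, c₃ < |p.2| → μ x p = 1) {x : X} (hμ : IsAdmissibleCutoff (G x) (μ x))
    (hG1 : ∀ u, G x u = 1 → u = 1) {p : ℂ × ℝ} (hp : p ∉ unknot) :
    ContDiffAt ℝ ∞ (fun q : X × (ℂ × ℝ) => phase (G q.1) (μ q.1) q.2) (x, p) := by
  have hraw : ContDiffAt ℝ ∞ (fun q : X × (ℂ × ℝ) => phaseRaw (G q.1) (μ q.1) q.2) (x, p) := by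
    by_cases hA : afun (G x) p = 0
    · -- far zero of `A`: the cut-off is complete near `p`
      have hs : c₃ < |p.2| := by
        by_contra hcon
        push Not at hcon
        exact hp (mem_unknot_of_afun_eq_zero hG1 (hcon.trans_lt hc₃) hA)
      have hev : ∀ᶠ q : X × (ℂ × ℝ) in nhds (x, p), phaseRaw (G q.1) (μ q.1) q.2 = 1 := by
        have ho : IsOpen {q : X × (ℂ × ℝ) | c₃ < |q.2.2|} :=
          isOpen_lt continuous_const (continuous_abs.comp (continuous_snd.comp continuous_snd))
        filter_upwards [ho.mem_nhds hs] with q hq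
        rw [phaseRaw, hfar q.1 q.2 hq]
        simp
      exact contDiffAt_const.congr_of_eventuallyEq hev
    · unfold phaseRaw
      exact ((Complex.ofRealCLM.contDiff.contDiffAt.comp (x, p)
        (contDiffAt_const.sub hμs.contDiffAt)).mul
        ((contDiffAt_nrm hA).comp (x, p) (contDiff_afun_family hG).contDiffAt)).add
        (Complex.ofRealCLM.contDiff.contDiffAt.comp (x, p) hμs.contDiffAt)
  have h1 : ContDiffAt ℝ ∞ (nrm ∘ fun q : X × (ℂ × ℝ) => phaseRaw (G q.1) (μ q.1) q.2) (x, p) :=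
    (contDiffAt_nrm (phaseRaw_ne_zero hμ hG1 hp)).comp (x, p) hraw
  exact h1.inv (nrm_ne_zero (phaseRaw_ne_zero hμ hG1 hp))

/-- The phase is smooth in `(ζ, c)` off the unknot for fixed admissible data. [folklore] -/
theorem contDiffAt_phase (hGs : ContDiff ℝ ∞ G) (hμs : ContDiff ℝ ∞ μ) {c₃ : ℝ}
    (hc₃ : c₃ < Real.pi) (hfar : ∀ p, c₃ < |p.2| → μ p = 1) (hμ : IsAdmissibleCutoff G μ)
    (hG1 : ∀ u, G u = 1 → u = 1) {p : ℂ × ℝ} (hp : p ∉ unknot) : ContDiffAt ℝ ∞ (phase G μ) p :=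
  (contDiffAt_phase_family (X := ℝ) (G := fun _ => G) (μ := fun _ => μ) (hGs.comp contDiff_snd)
    (hμs.comp contDiff_snd) hc₃ (fun _ => hfar) (x := 0) hμ hG1 hp).comp p
    (contDiffAt_const.prodMk contDiffAt_id)

/-! ### The singular self-maps `Θ, Θ⁻¹` of `ℝ³ ∖ U` -/

/-- **The surgery map** `Θ (ζ, c) = (P(ζ, c) · ζ, c)`: rotate the horizontal coordinate by the
surgery phase. A smooth self-map of `ℝ³ ∖ U` (the phase winds once around `U`, so `Θ` does not
extend across `U`), the identity where the cut-off is complete, realising the Dehn surgery of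
type `(1, ±1)` on the unknot (sign conventions aside): Iwase (1988), proof of Prop. 3.5 (the map
`F_*`); Rolfsen (1976), §9.H. [cite: Iwase1988, proof of Prop. 3.5 (p. 297)] -/
def theta (G : ℝ → ℝ) (μ : ℂ × ℝ → ℝ) (p : ℂ × ℝ) : ℂ × ℝ := (phase G μ p * p.1, p.2)

/-- **The inverse surgery map** `Θ⁻¹ (ζ, c) = (P(ζ, c)⁻¹ · ζ, c)`.
[cite: Iwase1988, proof of Prop. 3.5 (p. 297)] -/
def thetaInv (G : ℝ → ℝ) (μ : ℂ × ℝ → ℝ) (p : ℂ × ℝ) : ℂ × ℝ := ((phase G μ p)⁻¹ * p.1, p.2)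

section Theta

variable (hμ : IsAdmissibleCutoff G μ) (hG1 : ∀ u, G u = 1 → u = 1)
include hμ hG1

/-- `Θ` preserves `(‖ζ‖, c)` off the unknot. [folklore] -/
theorem norm_theta_fst {p : ℂ × ℝ} (hp : p ∉ unknot) : ‖(theta G μ p).1‖ = ‖p.1‖ := by
  rw [theta, norm_mul, norm_phase hμ hG1 hp, one_mul]

/-- `Θ⁻¹` preserves `(‖ζ‖, c)` off the unknot. [folklore] -/
theorem norm_thetaInv_fst {p : ℂ × ℝ} (hp : p ∉ unknot) : ‖(thetaInv G μ p).1‖ = ‖p.1‖ := by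
  rw [thetaInv, norm_mul, norm_inv, norm_phase hμ hG1 hp, inv_one, one_mul]

/-- `Θ` maps the complement of the unknot to itself. [folklore] -/
theorem theta_not_mem {p : ℂ × ℝ} (hp : p ∉ unknot) : theta G μ p ∉ unknot := fun h =>
  hp ⟨(norm_theta_fst hμ hG1 hp).symm.trans h.1, h.2⟩

/-- `Θ⁻¹` maps the complement of the unknot to itself. [folklore] -/
theorem thetaInv_not_mem {p : ℂ × ℝ} (hp : p ∉ unknot) : thetaInv G μ p ∉ unknot := fun h =>
  hp ⟨(norm_thetaInv_fst hμ hG1 hp).symm.trans h.1, h.2⟩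

/-- `Θ` maps `ℝ³ ∖ U` to itself. [folklore] -/
theorem mapsTo_theta : MapsTo (theta G μ) unknotᶜ unknotᶜ := fun _ hp => theta_not_mem hμ hG1 hp

/-- `Θ⁻¹` maps `ℝ³ ∖ U` to itself. [folklore] -/
theorem mapsTo_thetaInv : MapsTo (thetaInv G μ) unknotᶜ unknotᶜ := fun _ hp =>
  thetaInv_not_mem hμ hG1 hp

/-- The phase is unchanged by `Θ` (for a cut-off depending only on `(‖ζ‖, c)`). [folklore] -/
theorem phase_theta (hμn : ∀ p p' : ℂ × ℝ, ‖p.1‖ = ‖p'.1‖ → p.2 = p'.2 → μ p = μ p')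
    {p : ℂ × ℝ} (hp : p ∉ unknot) : phase G μ (theta G μ p) = phase G μ p :=
  phase_eq_of_norm_eq (norm_theta_fst hμ hG1 hp) rfl (hμn _ _ (norm_theta_fst hμ hG1 hp) rfl)

/-- The phase is unchanged by `Θ⁻¹`. [folklore] -/
theorem phase_thetaInv (hμn : ∀ p p' : ℂ × ℝ, ‖p.1‖ = ‖p'.1‖ → p.2 = p'.2 → μ p = μ p')
    {p : ℂ × ℝ} (hp : p ∉ unknot) : phase G μ (thetaInv G μ p) = phase G μ p :=
  phase_eq_of_norm_eq (norm_thetaInv_fst hμ hG1 hp) rfl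
    (hμn _ _ (norm_thetaInv_fst hμ hG1 hp) rfl)

/-- **`Θ ∘ Θ⁻¹ = id` off the unknot.** [folklore] -/
theorem theta_thetaInv (hμn : ∀ p p' : ℂ × ℝ, ‖p.1‖ = ‖p'.1‖ → p.2 = p'.2 → μ p = μ p')
    {p : ℂ × ℝ} (hp : p ∉ unknot) : theta G μ (thetaInv G μ p) = p := by
  have h := phase_ne_zero hμ hG1 hp
  rw [theta, phase_thetaInv hμ hG1 hμn hp, thetaInv, Prod.mk.injEq]
  exact ⟨by rw [← mul_assoc, mul_inv_cancel₀ h, one_mul], rfl⟩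

/-- **`Θ⁻¹ ∘ Θ = id` off the unknot.** [folklore] -/
theorem thetaInv_theta (hμn : ∀ p p' : ℂ × ℝ, ‖p.1‖ = ‖p'.1‖ → p.2 = p'.2 → μ p = μ p')
    {p : ℂ × ℝ} (hp : p ∉ unknot) : thetaInv G μ (theta G μ p) = p := by
  have h := phase_ne_zero hμ hG1 hp
  rw [thetaInv, phase_theta hμ hG1 hμn hp, theta, Prod.mk.injEq]
  exact ⟨by rw [← mul_assoc, inv_mul_cancel₀ h, one_mul], rfl⟩

/-- `Θ` is a bijection of `ℝ³ ∖ U` onto itself with inverse `Θ⁻¹`. [folklore] -/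
theorem bijOn_theta (hμn : ∀ p p' : ℂ × ℝ, ‖p.1‖ = ‖p'.1‖ → p.2 = p'.2 → μ p = μ p') :
    BijOn (theta G μ) unknotᶜ unknotᶜ :=
  ⟨mapsTo_theta hμ hG1, fun p hp p' hp' h => by
    rw [← thetaInv_theta hμ hG1 hμn hp, ← thetaInv_theta hμ hG1 hμn hp', h],
    fun q hq => ⟨thetaInv G μ q, thetaInv_not_mem hμ hG1 hq, theta_thetaInv hμ hG1 hμn hq⟩⟩

end Theta

/-- **`Θ` is the identity where the cut-off is complete.** [folklore] -/
theorem theta_eq_self {p : ℂ × ℝ} (hp : μ p = 1) : theta G μ p = p := by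
  rw [theta, phase_eq_one_of_cutoff_eq_one hp, one_mul]

/-- **`Θ⁻¹` is the identity where the cut-off is complete.** [folklore] -/
theorem thetaInv_eq_self {p : ℂ × ℝ} (hp : μ p = 1) : thetaInv G μ p = p := by
  rw [thetaInv, phase_eq_one_of_cutoff_eq_one hp, inv_one, one_mul]

/-- **`Θ` is jointly smooth in the parameters and `(ζ, c)` off the unknot** (hypotheses as in
`contDiffAt_phase_family`). [folklore] -/
theorem contDiffAt_theta_family {X : Type*} [NormedAddCommGroup X] [NormedSpace ℝ X]
    {G : X → ℝ → ℝ} {μ : X → ℂ × ℝ → ℝ} (hG : ContDiff ℝ ∞ fun q : X × ℝ => G q.1 q.2)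
    (hμs : ContDiff ℝ ∞ fun q : X × (ℂ × ℝ) => μ q.1 q.2) {c₃ : ℝ} (hc₃ : c₃ < Real.pi)
    (hfar : ∀ x p, c₃ < |p.2| → μ x p = 1) {x : X} (hμ : IsAdmissibleCutoff (G x) (μ x))
    (hG1 : ∀ u, G x u = 1 → u = 1) {p : ℂ × ℝ} (hp : p ∉ unknot) :
    ContDiffAt ℝ ∞ (fun q : X × (ℂ × ℝ) => theta (G q.1) (μ q.1) q.2) (x, p) :=
  ((contDiffAt_phase_family hG hμs hc₃ hfar hμ hG1 hp).mul
    (contDiffAt_fst.comp (x, p) contDiffAt_snd)).prodMk (contDiffAt_snd.comp (x, p) contDiffAt_snd)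

/-- **`Θ⁻¹` is jointly smooth in the parameters and `(ζ, c)` off the unknot.** [folklore] -/
theorem contDiffAt_thetaInv_family {X : Type*} [NormedAddCommGroup X] [NormedSpace ℝ X]
    {G : X → ℝ → ℝ} {μ : X → ℂ × ℝ → ℝ} (hG : ContDiff ℝ ∞ fun q : X × ℝ => G q.1 q.2)
    (hμs : ContDiff ℝ ∞ fun q : X × (ℂ × ℝ) => μ q.1 q.2) {c₃ : ℝ} (hc₃ : c₃ < Real.pi)
    (hfar : ∀ x p, c₃ < |p.2| → μ x p = 1) {x : X} (hμ : IsAdmissibleCutoff (G x) (μ x))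
    (hG1 : ∀ u, G x u = 1 → u = 1) {p : ℂ × ℝ} (hp : p ∉ unknot) :
    ContDiffAt ℝ ∞ (fun q : X × (ℂ × ℝ) => thetaInv (G q.1) (μ q.1) q.2) (x, p) :=
  (((contDiffAt_phase_family hG hμs hc₃ hfar hμ hG1 hp).inv (phase_ne_zero hμ hG1 hp)).mul
    (contDiffAt_fst.comp (x, p) contDiffAt_snd)).prodMk (contDiffAt_snd.comp (x, p) contDiffAt_snd)

/-- `Θ` is smooth on `ℝ³ ∖ U` for fixed admissible smooth data. [folklore] -/
theorem contDiffOn_theta (hGs : ContDiff ℝ ∞ G) (hμs : ContDiff ℝ ∞ μ) {c₃ : ℝ}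
    (hc₃ : c₃ < Real.pi) (hfar : ∀ p, c₃ < |p.2| → μ p = 1) (hμ : IsAdmissibleCutoff G μ)
    (hG1 : ∀ u, G u = 1 → u = 1) : ContDiffOn ℝ ∞ (theta G μ) unknotᶜ := fun p hp =>
  ((contDiffAt_theta_family (X := ℝ) (G := fun _ => G) (μ := fun _ => μ) (hGs.comp contDiff_snd)
    (hμs.comp contDiff_snd) hc₃ (fun _ => hfar) (x := 0) hμ hG1 hp).comp p
    (contDiffAt_const.prodMk contDiffAt_id)).contDiffWithinAt

/-- `Θ⁻¹` is smooth on `ℝ³ ∖ U` for fixed admissible smooth data. [folklore] -/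
theorem contDiffOn_thetaInv (hGs : ContDiff ℝ ∞ G) (hμs : ContDiff ℝ ∞ μ) {c₃ : ℝ}
    (hc₃ : c₃ < Real.pi) (hfar : ∀ p, c₃ < |p.2| → μ p = 1) (hμ : IsAdmissibleCutoff G μ)
    (hG1 : ∀ u, G u = 1 → u = 1) : ContDiffOn ℝ ∞ (thetaInv G μ) unknotᶜ := fun p hp =>
  ((contDiffAt_thetaInv_family (X := ℝ) (G := fun _ => G) (μ := fun _ => μ)
    (hGs.comp contDiff_snd) (hμs.comp contDiff_snd) hc₃ (fun _ => hfar) (x := 0) hμ hG1 hp).comp p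
    (contDiffAt_const.prodMk contDiffAt_id)).contDiffWithinAt

/-! ### The adapted tube around the unknot and the exact tube relations -/

/-- **The adapted tubular parametrisation of the unknot** for a profile of slope `-m` at `u = 1`:
the point with core point `z ∈ S¹ ⊆ ℂ` and normal coordinate `n ∈ ℂ` is `(ρ · z, c)` with
`ρ² = G_m⁻¹(‖1 - n‖) = 1 + (1 - ‖1 - n‖)/m` and `c = -arg (1 - n)`, so that `A = n` EXACTLY on the
tube (`afun_tube`). [folklore] -/
def tube (m : ℝ) (z n : ℂ) : ℂ × ℝ :=
  (Complex.ofReal (Real.sqrt (1 + (1 - ‖1 - n‖) / m)) * z, -arg (1 - n))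

variable {m : ℝ} {z n : ℂ}

/-- `|1 - ‖1 - n‖| ≤ ‖n‖` (reverse triangle inequality). [folklore] -/
theorem abs_one_sub_norm_le (n : ℂ) : |1 - ‖1 - n‖| ≤ ‖n‖ := by
  have h := abs_norm_sub_norm_le (1 : ℂ) (1 - n)
  rwa [norm_one, sub_sub_cancel] at h

/-- On the thin tube `‖n‖ ≤ m/4` the squared radius `ρ²` lies in `[3/4, 5/4]`. [folklore] -/
theorem rhoSq_mem (hm : 0 < m) (hn' : ‖n‖ ≤ m / 4) :
    3 / 4 ≤ 1 + (1 - ‖1 - n‖) / m ∧ 1 + (1 - ‖1 - n‖) / m ≤ 5 / 4 := by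
  have h := abs_one_sub_norm_le n
  rw [abs_le] at h
  have h1 : (1 - ‖1 - n‖) / m ≤ 1 / 4 := by
    rw [div_le_iff₀ hm]; linarith
  have h2 : -(1 / 4) ≤ (1 - ‖1 - n‖) / m := by
    rw [le_div_iff₀ hm]; linarith
  constructor <;> linarith

/-- `1 - n` lies in the right half plane for `‖n‖ ≤ 1/4`. [folklore] -/
theorem one_sub_re_pos (hn : ‖n‖ ≤ 1 / 4) : 0 < (1 - n).re := by
  have := (abs_re_le_norm n).trans hn
  rw [Complex.sub_re, Complex.one_re]
  linarith [(abs_le.1 this).2]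

/-- The radius of a tube point. [folklore] -/
theorem norm_tube_fst (m : ℝ) (hz : ‖z‖ = 1) (n : ℂ) :
    ‖(tube m z n).1‖ = Real.sqrt (1 + (1 - ‖1 - n‖) / m) := by
  rw [tube, norm_mul, hz, mul_one, Complex.norm_real, Real.norm_eq_abs,
    abs_of_nonneg (Real.sqrt_nonneg _)]

/-- The squared radius of a tube point is within `1/4` of `1` (so the profile is affine there).
[folklore] -/
theorem abs_norm_tube_sq_sub_one_le (hm : 0 < m) (hz : ‖z‖ = 1) (hn' : ‖n‖ ≤ m / 4) :
    |‖(tube m z n).1‖ ^ 2 - 1| ≤ 1 / 4 := by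
  have hρ := rhoSq_mem hm hn'
  rw [norm_tube_fst m hz n, Real.sq_sqrt (by linarith), abs_le]
  constructor <;> linarith

/-- On the tube, `G(ρ²) = ‖1 - n‖` for a profile affine of slope `-m` near `u = 1`. [folklore] -/
theorem profile_tube (hGm : ∀ u, |u - 1| ≤ 1 / 4 → G u = gaff m u) (hm : 0 < m) (hz : ‖z‖ = 1)
    (hn' : ‖n‖ ≤ m / 4) : G (‖(tube m z n).1‖ ^ 2) = ‖1 - n‖ := by
  rw [hGm _ (abs_norm_tube_sq_sub_one_le hm hz hn'), norm_tube_fst m hz n,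
    Real.sq_sqrt (by linarith [(rhoSq_mem hm hn').1]), gaff]
  field_simp
  ring

/-- **On the tube, `A = n` exactly.** [folklore] -/
theorem afun_tube (hGm : ∀ u, |u - 1| ≤ 1 / 4 → G u = gaff m u) (hm : 0 < m) (hz : ‖z‖ = 1)
    (hn : ‖n‖ ≤ 1 / 4) (hn' : ‖n‖ ≤ m / 4) : afun G (tube m z n) = n := by
  have hne : (1 : ℂ) - n ≠ 0 := fun h => by
    have := one_sub_re_pos hn; rw [h] at this; simp at this
  have hnorm : ‖(1 : ℂ) - n‖ ≠ 0 := norm_ne_zero_iff.2 hne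
  apply Complex.ext
  · rw [afun_re, profile_tube hGm hm hz hn']
    simp only [tube, Real.cos_neg, Complex.cos_arg hne]
    field_simp
    simp
  · rw [afun_im, profile_tube hGm hm hz hn']
    simp only [tube, Real.sin_neg, Complex.sin_arg]
    field_simp
    simp

/-- The height of a tube point is at most `π/2 < 1.6` in absolute value. [folklore] -/
theorem abs_tube_snd_le (hn : ‖n‖ ≤ 1 / 4) : |(tube m z n).2| ≤ 1.6 := by
  have harg : |arg (1 - n)| ≤ Real.pi / 2 := abs_arg_le_pi_div_two_iff.2 (one_sub_re_pos hn).le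
  have hπ : Real.pi < 3.15 := Real.pi_lt_d2
  simp only [tube, abs_neg]
  linarith

/-- A tube point lies on the unknot iff its normal coordinate vanishes. [folklore] -/
theorem tube_mem_unknot_iff (hm : 0 < m) (hz : ‖z‖ = 1) (hn : ‖n‖ ≤ 1 / 4) (hn' : ‖n‖ ≤ m / 4) :
    tube m z n ∈ unknot ↔ n = 0 := by
  constructor
  · rintro ⟨h1, h2⟩
    rw [norm_tube_fst m hz n, Real.sqrt_eq_one] at h1
    have hnorm : ‖(1 : ℂ) - n‖ = 1 := by
      have : (1 - ‖1 - n‖) / m = 0 := by linarith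
      rw [div_eq_zero_iff, or_iff_left hm.ne'] at this
      linarith
    simp only [tube, neg_eq_zero] at h2
    obtain ⟨hre, him⟩ := arg_eq_zero_iff.1 h2
    have hreal : (1 : ℂ) - n = (((1 : ℂ) - n).re : ℂ) := Complex.ext (by simp) (by simpa using him)
    rw [hreal, Complex.norm_real, Real.norm_eq_abs, abs_of_nonneg hre, Complex.sub_re,
      Complex.one_re] at hnorm
    rw [Complex.sub_im, Complex.one_im] at him
    exact Complex.ext (by simp; linarith) (by simp; linarith)
  · rintro rfl
    refine ⟨?_, ?_⟩
    · rw [norm_tube_fst m hz 0]; simp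
    · simp [tube]

/-- A tube point is off the unknot iff its normal coordinate is non-zero. [folklore] -/
theorem tube_not_mem (hm : 0 < m) (hz : ‖z‖ = 1) (hn : ‖n‖ ≤ 1 / 4) (hn' : ‖n‖ ≤ m / 4)
    (hn0 : n ≠ 0) : tube m z n ∉ unknot := fun h => hn0 ((tube_mem_unknot_iff hm hz hn hn').1 h)

/-- **Admissible tube data**: the profile is affine of slope `-m < 0` near `u = 1`, and the cut-off
vanishes on the tube region `{|‖ζ‖² - 1| ≤ 1/4, |c| ≤ 1.6}`. [folklore] -/
structure IsTubeAdapted (G : ℝ → ℝ) (μ : ℂ × ℝ → ℝ) (m : ℝ) : Prop where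
  pos : 0 < m
  profile_eq : ∀ u, |u - 1| ≤ 1 / 4 → G u = gaff m u
  cutoff_eq_zero : ∀ p : ℂ × ℝ, |‖p.1‖ ^ 2 - 1| ≤ 1 / 4 → |p.2| ≤ 1.6 → μ p = 0

/-- **The phase on the tube is the inverse unit vector of the normal coordinate.** [folklore] -/
theorem phase_tube (h : IsTubeAdapted G μ m) (hz : ‖z‖ = 1) (hn : ‖n‖ ≤ 1 / 4) (hn' : ‖n‖ ≤ m / 4) :
    phase G μ (tube m z n) = (nrm n)⁻¹ := by
  rw [phase_eq_of_cutoff_eq_zero (h.cutoff_eq_zero _ (abs_norm_tube_sq_sub_one_le h.pos hz hn')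
    (abs_tube_snd_le hn)), afun_tube h.profile_eq h.pos hz hn hn']

/-- **Exact tube relation for `Θ`**: precomposed with the shear "rotate the core point by the unit
normal vector", `Θ` is the tube map itself: `Θ (tube m (z · n/‖n‖) n) = tube m z n` for `n ≠ 0`.
In the language of Dehn surgery: regluing the tube by "meridian ↦ meridian ± longitude" makes
`Θ` smooth across the core, with no further twist. [cite: Iwase1988, proof of Prop. 3.5 (p. 297)] -/
theorem theta_tube (h : IsTubeAdapted G μ m) (hz : ‖z‖ = 1) (hn : ‖n‖ ≤ 1 / 4) (hn' : ‖n‖ ≤ m / 4)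
    (hn0 : n ≠ 0) : theta G μ (tube m (z * nrm n) n) = tube m z n := by
  have hz' : ‖z * nrm n‖ = 1 := by rw [norm_mul, norm_nrm hn0, mul_one, hz]
  have hnn : nrm n ≠ 0 := nrm_ne_zero hn0
  rw [theta, phase_tube h hz' hn hn', Prod.mk.injEq]
  refine ⟨?_, rfl⟩
  simp only [tube]
  field_simp

/-- **Exact tube relation for `Θ⁻¹`**: `Θ⁻¹ (tube m (z · (n/‖n‖)⁻¹) n) = tube m z n` for `n ≠ 0`.
[cite: Iwase1988, proof of Prop. 3.5 (p. 297)] -/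
theorem thetaInv_tube (h : IsTubeAdapted G μ m) (hz : ‖z‖ = 1) (hn : ‖n‖ ≤ 1 / 4)
    (hn' : ‖n‖ ≤ m / 4) (hn0 : n ≠ 0) : thetaInv G μ (tube m (z * (nrm n)⁻¹) n) = tube m z n := by
  have hz' : ‖z * (nrm n)⁻¹‖ = 1 := by rw [norm_mul, norm_inv, norm_nrm hn0, inv_one, mul_one, hz]
  have hnn : nrm n ≠ 0 := nrm_ne_zero hn0
  rw [thetaInv, phase_tube h hz' hn hn', Prod.mk.injEq]
  refine ⟨?_, rfl⟩
  simp only [tube]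
  field_simp

/-- The same relation read as "`Θ` of a tube point is the tube point with rotated core":
`Θ (tube m z n) = tube m (z · (n/‖n‖)⁻¹) n`. [folklore] -/
theorem theta_tube' (h : IsTubeAdapted G μ m) (hz : ‖z‖ = 1) (hn : ‖n‖ ≤ 1 / 4) (hn' : ‖n‖ ≤ m / 4)
    (hn0 : n ≠ 0) : theta G μ (tube m z n) = tube m (z * (nrm n)⁻¹) n := by
  have hz' : ‖z * (nrm n)⁻¹‖ = 1 := by rw [norm_mul, norm_inv, norm_nrm hn0, inv_one, mul_one, hz]
  have h' := theta_tube h hz' hn hn' hn0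
  rwa [inv_mul_cancel_right₀ (nrm_ne_zero hn0)] at h'

/-- **The tube is jointly smooth** in `(m, z, n)` on the open set `{0 < m, ‖n‖ < 1/4, ‖n‖ < m/4}`
(square root of a positive quantity; the argument is smooth on the slit plane). [folklore] -/
theorem contDiffAt_tube (hm : 0 < m) (hn : ‖n‖ < 1 / 4) (hn' : ‖n‖ < m / 4) :
    ContDiffAt ℝ ∞ (fun q : ℝ × ℂ × ℂ => tube q.1 q.2.1 q.2.2) (m, z, n) := by
  have hρ := (rhoSq_mem hm hn'.le).1
  have hsub : ContDiffAt ℝ ∞ (fun q : ℝ × ℂ × ℂ => (1 : ℂ) - q.2.2) (m, z, n) :=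
    contDiffAt_const.sub (contDiffAt_snd.comp _ contDiffAt_snd)
  have hne : (1 : ℂ) - n ≠ 0 := fun h => by
    have := one_sub_re_pos hn.le; rw [h] at this; simp at this
  have hnormC : ContDiffAt ℝ ∞ (fun q : ℝ × ℂ × ℂ => ‖(1 : ℂ) - q.2.2‖) (m, z, n) :=
    (contDiffAt_norm ℝ hne).comp (m, z, n) hsub
  have hrho : ContDiffAt ℝ ∞ (fun q : ℝ × ℂ × ℂ => 1 + (1 - ‖(1 : ℂ) - q.2.2‖) / q.1) (m, z, n) :=
    contDiffAt_const.add ((contDiffAt_const.sub hnormC).div contDiffAt_fst hm.ne')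
  have harg : ContDiffAt ℝ ∞ (arg ∘ fun q : ℝ × ℂ × ℂ => (1 : ℂ) - q.2.2) (m, z, n) :=
    (contDiffAt_arg (mem_slitPlane_iff.2 (Or.inl (one_sub_re_pos hn.le)))).comp
      (m, z, n) hsub
  unfold tube
  exact ((Complex.ofRealCLM.contDiff.contDiffAt.comp (m, z, n) (hrho.sqrt (by linarith))).mul
    (contDiffAt_fst.comp (m, z, n) contDiffAt_snd)).prodMk harg.neg

/-! ### The standard data: affine profile and radial cut-off -/

/-- **The standard radial cut-off** `μ = smoothTransition (‖ζ‖² + c² - 4)` is admissible for every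
profile `G` with `1 < G u → u < 1` (in particular for `gaff m`, `m > 0`). [folklore] -/
theorem isAdmissibleCutoff_cutoff (hG : ∀ u, 1 < G u → u < 1) : IsAdmissibleCutoff G cutoff where
  nonneg _ := Real.smoothTransition.nonneg _
  le_one _ := Real.smoothTransition.le_one _
  abs_lt_pi p hp := by
    refine abs_lt_pi_of_sqRad_lt (not_le.1 fun h5 => ?_)
    exact hp.ne (cutoff_eq_one h5)
  eq_zero_of_disc p hc hGp := cutoff_eq_zero (by
    unfold sqRad; rw [hc]; nlinarith [hG _ hGp])

/-- The standard cut-off is complete beyond the height `√5 < 3 < π`. [folklore] -/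
theorem cutoff_eq_one_of_lt {p : ℂ × ℝ} (hp : 3 < |p.2|) : cutoff p = 1 :=
  cutoff_eq_one (by unfold sqRad; nlinarith [sq_nonneg ‖p.1‖, sq_abs p.2, abs_nonneg p.2])

/-- For the affine profile of slope `-m < 0`, `1 < G u → u < 1`. [folklore] -/
theorem lt_one_of_one_lt_gaff {m : ℝ} (hm : 0 < m) (u : ℝ) (h : 1 < gaff m u) : u < 1 := by
  unfold gaff at h; nlinarith

/-- For the affine profile of slope `-m`, `m ≠ 0`, `G u = 1 → u = 1`. [folklore] -/
theorem eq_one_of_gaff_eq_one {m : ℝ} (hm : m ≠ 0) (u : ℝ) (h : gaff m u = 1) : u = 1 := by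
  unfold gaff at h
  have : m * (u - 1) = 0 := by linarith
  rcases mul_eq_zero.1 this with h' | h'
  · exact absurd h' hm
  · linarith

/-- **The standard data `(gaff m, cutoff, m)` are tube adapted** for `m > 0`. [folklore] -/
theorem isTubeAdapted_gaff_cutoff {m : ℝ} (hm : 0 < m) : IsTubeAdapted (gaff m) cutoff m where
  pos := hm
  profile_eq _ _ := rfl
  cutoff_eq_zero p h1 h2 := cutoff_eq_zero (by
    unfold sqRad
    have hu := (abs_le.1 h1).2
    have hc : p.2 ^ 2 ≤ 1.6 ^ 2 := by
      rw [← sq_abs]; exact pow_le_pow_left₀ (abs_nonneg _) h2 2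
    nlinarith)

end UnknotSurgery
end Literature.Topology.FourManifolds
end
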